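import Literature.IUT.HodgeArakelov.LabelClassesOfCuspsCor24iGraphLevelsOfSpecialFibre
import Literature.IUT.HodgeArakelov.LabelClassesOfCuspsCor24iOfSpecialFibreComap
import HarnessLib

/-!
# [IUTchII] Cor 2.4 (i) at a special-fibre agreement: the last two `eHat`-dependent inputs of the (B)-chain made intrinsic

S. Mochizuki, *Inter-universal Teichmüller Theory II*, kurims manuscript (Dec. 2020), §2, Def 2.3 (i) p. 67 («`Π̂_v`, `Π̂^±_v` … the respective
profinite completions», `Π_{v▶} ⊆ Π_v`), Cor 2.4 (i) pp. 69–71 (proof p. 70 l. −5 – p. 71 l. 5); *… I* (May 2020), §2, Cor 2.3 pp. 47–48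
[cite: Mochizuki2012, II Cor 2.4 (i) pp.69–71] (D-0012 claim key, status DISPUTED: every [IUTchI]/[IUTchII]/[SemiAnbd] statement below is a
HYPOTHESIS named by the tree's typed predicates or a kernel theorem about the tree's own constructions; nothing printed is asserted).

abc-iut cell, node **IUTchII:Cor2.4(i)** (CONE-BOARD claimant abc-iut-w4-d012; gen 6, part 6), GAP-LEDGER G-w4d012-2.  PROOF-ONLY (no `def` /
`instance` / `structure`).  Part 4 (`cor24_i_ofSpecialFibre_graphTower`, p439150) still carried two hypotheses phrased through the agreement's
`∃`-produced `eHat`: the Δ-dictionary identity `hDic` and «levels below `Π̂_v`» `hlevV : Ĵ_i ≤ eHat(Π̂_v ∩ Π̂^±_v)`.  abc-iut-w5-d132's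
`StableCurveAgreement.deltaPmBox_comap_eq_ofSpecialFibre` (p438242) DISCHARGES `hDic` at the decomposition subgroup
`H▶' := incl⁻¹(φ⁻¹ Π^tp_{X,ℍ'})` («`Π_{v▶} = Π_v ∩ Π^tp_{X̲_v,ℍ}`», print p. 70 «where `ℍ = Γ_□`») modulo [IUTchI] Cor 2.3 (iii)(iv) of the
`ℍ'`-datum; here `hlevV` is REWRITTEN intrinsically:

* `StableCurveAgreement.coe_map_eHat_hat_subgroupOf` — for ANY tower whose `Π̂_v` is the closure of `Π_v` in `Π̂^cor_v` (`hhat`; true for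
  abc-iut-L6-t19's `ofCoverModel` / `ofPiCHat` by construction, `ofPiCHat_piPM_piV_deltaCorHat`) and any BICONTINUOUS agreement restricting on
  `Π^±_v` to `φ` (`hφ`): **`eHat(Π̂_v ∩ Π̂^±_v) = closure of ιX(φ(Π_v)) in Π̂_X`** — i.e. `Π̂_v` corresponds to `Π̂_{X̲̲_v} ⊆ Π̂_{X̲_v}`, the closure of
  the image of `Π^tp_{X̲̲_v}` (an `eHat`-free subgroup of the datum);
* `StableCurveAgreement.hlevV_of_le_closure` — hence «levels below `Π̂_v`» ⟸ «`Ĵ_i ⊆` closure of `ιX(φ(Π_v))`», a condition on the admissible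
  tower of the datum alone;
* **`StableCurveAgreement.cor24_i_ofSpecialFibre_graphTower_comap`** — the landed predicate `Cor24_i W Cu H▶' I` at an agreement with a
  special-fibre datum with NO `eHat`-phrased hypothesis left: inputs = [IUTchI] Prop 2.4 (i) of the datum; per sub-graph `ℍ'` (`Π̂_{ℍ'}` its
  closure): [IUTchI] Cor 2.3 (iii), (iv), (v) under `Cor23Hyp` (L5 nodes BY NAME), an ADMISSIBLE tower `Tw` of the `ℍ'`-datum (levels
  `ρ̂⁻¹(V_i)`, `V_i ⊴ Π̂_𝔾` open, shrinking to `1`) realised by coverings of semi-graphs `Cv` whose level data satisfy [IUTchI] Cor 2.3 (vi) BY NAME,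
  the (D3) stabiliser statement, and `Ĵ_i ⊆ cl ιX(φ(Π_v))`; tower side: the transported cuspidal datum (`hlev`), `Π_v ⊴ Π^±_v` of finite
  index, `Π^±_v ∩ Π̂_v ⊆ Π_v`, `Π̂_v = cl Π_v` — all four THEOREMS at `ofPiCHat` (parts 2–3, abc-iut-L6-t19, abc-iut-w5-d132).

HONEST LABEL: kernel assembly over named inputs; typed ≠ proved for the L5 nodes; nothing here takes a side on [IUTchIII] Cor 3.12 or asserts
anything of the series.
-/

noncomputable section

universe u

namespace Literature.IUT.HodgeArakelov

open Literature.IUT.HodgeTheaters Literature.AnabelianGeometry.SemiGraphs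
open _root_.Topology
open scoped Pointwise

namespace PlusMinusTower

namespace StableCurveAgreement

section Generic

variable {S : BadPlaceSetting.{u}} {P : TopGroup.{u}} {T : TemperedCoverings S P}
  {W : PlusMinusTower T} {C : CuspidalInertiaData W} {D : StableCurveTemperedData.{u}}

/-- **[IUTchII] Def 2.3 (i) — `Π̂_v ⊆ Π̂^±_v` corresponds to `Π̂_{X̲̲_v} ⊆ Π̂_{X̲_v}` under a bicontinuous agreement.**  If `Π̂_v` is the closure of
`Π_v` in `Π̂^cor_v` (`hhat`) and the agreement's `eHat` is a homeomorphism restricting on `Π^±_v` to `φ` (`hφ`), then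
`eHat(Π̂_v ∩ Π̂^±_v)` is the closure in `Π̂_X` of `ιX(φ(Π_v))`.  PROVED (closure in the closed subspace `Π̂^±_v` + image of a closure under a
homeomorphism). ([IUTchII] Def 2.3 (i), kurims p.67) [claim: Mochizuki2012, status: disputed] -/
theorem coe_map_eHat_hat_subgroupOf (A : StableCurveAgreement W C D) (hA : IsHomeomorph A.eHat)
    (hhat : (W.hat : Set W.Corhat) = closure (W.piV : Set W.Corhat))
    (φ : T.Xplain ≃* D.PiTp) (hφ : ∀ x : T.Xplain, A.eHat ⟨W.emb x, W.emb_le_pmHat ⟨x, rfl⟩⟩ = D.ιX (φ x)) :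
    (((W.hat.subgroupOf W.pmHat).map A.eHat.toMonoidHom : Subgroup D.PiHat) : Set D.PiHat) =
      closure (((T.incl.range.map φ.toMonoidHom).map D.ιX : Subgroup D.PiHat) : Set D.PiHat) := by
  -- `Π̂_v ∩ Π̂^±_v`, read in the subspace `Π̂^±_v`, is the closure there of `Π_v`
  have h1 : ((W.hat.subgroupOf W.pmHat : Subgroup W.pmHat) : Set W.pmHat) =
      closure ((Subtype.val : W.pmHat → W.Corhat) ⁻¹' (W.piV : Set W.Corhat)) := by
    rw [Topology.IsEmbedding.subtypeVal.closure_eq_preimage_closure_image, Set.image_preimage_eq_inter_range,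
      Subtype.range_coe, Set.inter_eq_left.mpr (show (W.piV : Set W.Corhat) ⊆ W.pmHat from
        fun _ hx => W.emb_le_pmHat (W.piV_le_piPM hx)), ← hhat]
    rfl
  -- `eHat(Π_v) = ιX(φ(Π_v))`
  have h2 : (A.eHat : W.pmHat → D.PiHat) '' ((Subtype.val : W.pmHat → W.Corhat) ⁻¹' (W.piV : Set W.Corhat)) =
      (((T.incl.range.map φ.toMonoidHom).map D.ιX : Subgroup D.PiHat) : Set D.PiHat) := by
    ext y
    constructor
    · rintro ⟨q, hq, rfl⟩
      obtain ⟨z, hz⟩ := MonoidHom.mem_range.mp hq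
      have hq' : q = ⟨W.emb (T.incl z), W.emb_le_pmHat ⟨T.incl z, rfl⟩⟩ := Subtype.ext hz.symm
      refine ⟨φ.toMonoidHom (T.incl z), ⟨T.incl z, ⟨z, rfl⟩, rfl⟩, ?_⟩
      rw [hq', hφ]
      rfl
    · rintro ⟨_, ⟨_, ⟨z, rfl⟩, rfl⟩, rfl⟩
      exact ⟨⟨W.emb (T.incl z), W.emb_le_pmHat ⟨T.incl z, rfl⟩⟩, ⟨z, rfl⟩, hφ (T.incl z)⟩
  rw [Subgroup.coe_map, MulEquiv.coe_toMonoidHom, h1, hA.image_closure, h2]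

/-- **«levels below `Π̂_v`» made intrinsic**: under the hypotheses of `coe_map_eHat_hat_subgroupOf`, the binder
`hlevV : Ĵ_i ≤ eHat(Π̂_v ∩ Π̂^±_v)` of the (B)-chain follows from `Ĵ_i ⊆` closure of `ιX(φ(Π_v))` in `Π̂_X` (a condition on the tower of the
datum alone).  PROVED. ([IUTchII] Def 2.3 (i), kurims p.67) [claim: Mochizuki2012, status: disputed] -/
theorem hlevV_of_le_closure (A : StableCurveAgreement W C D) (hA : IsHomeomorph A.eHat)
    (hhat : (W.hat : Set W.Corhat) = closure (W.piV : Set W.Corhat))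
    (φ : T.Xplain ≃* D.PiTp) (hφ : ∀ x : T.Xplain, A.eHat ⟨W.emb x, W.emb_le_pmHat ⟨x, rfl⟩⟩ = D.ιX (φ x))
    {ι' : Type*} (J : ι' → Subgroup D.PiHat)
    (hJ : ∀ i, (J i : Set D.PiHat) ⊆ closure (((T.incl.range.map φ.toMonoidHom).map D.ιX : Subgroup D.PiHat) : Set D.PiHat)) :
    ∀ i, J i ≤ (W.hat.subgroupOf W.pmHat).map A.eHat.toMonoidHom := by
  intro i y hy
  have h := hJ i hy
  rw [← A.coe_map_eHat_hat_subgroupOf hA hhat φ hφ] at h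
  exact h

end Generic

/-! ### The assembly at a special-fibre agreement, no `eHat`-phrased hypothesis left -/

section SpecialFibre

variable {S : BadPlaceSetting.{0}} {P : TopGroup.{0}} {T : TemperedCoverings S P} {W : PlusMinusTower T}
  {Cu : CuspidalInertiaData W}
  {p : ℕ} [Fact p.Prime] {X : TemperedCurve p} {d : X.GroupLevelData}
  {Sf : SpecialFibreData (X.toTemperedArithmeticGroup d)} {h36 : Sf.Gc.Prop36Hypotheses}
  {Sigma SigmaHat : Set ℕ} {hsub : Sigma ⊆ SigmaHat} {hne : Sigma.Nonempty}
  {hprime : ∀ q ∈ SigmaHat, q.Prime} {hp : p ∉ Sigma} {TpH : Subgroup Sf.chart.G}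
  {HatH : Subgroup (TemperedGraphGroupData.exists_completion_of_prop36 Sf.Gc h36 Sf.chart).choose}
  {hle : TpH.map (TemperedGraphGroupData.exists_completion_of_prop36 Sf.Gc h36
    Sf.chart).choose_spec.choose.toMonoidHom ≤ HatH}
  {cMH : {x : X.Pt // X.IsCusp x} → Prop}

/-- **[IUTchII] Cor 2.4 (i) (landed predicate `Cor24_i W Cu H▶' I`) at an agreement with a special-fibre datum — (A) modulo Prop 2.4 (i), (B)
over an admissible tower, (C) modulo Cor 2.3 (v), the dictionary and «levels below `Π̂_v`» intrinsic.**  For the decomposition subgroup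
`H▶' := incl⁻¹(φ⁻¹ Π^tp_{X,ℍ'})` of a sub-graph `ℍ'` (print p. 70 «where `ℍ = Γ_□`») and any `I ⊆ Δ̂^cor_v`: part 4's
`cor24_i_ofSpecialFibre_graphTower` with `hDic` DISCHARGED by abc-iut-w5-d132's `deltaPmBox_comap_eq_ofSpecialFibre` and `hlevV` by
`hlevV_of_le_closure`.  HYPOTHESES (all NAMED): tower side — transported cuspidal datum `hlev`, `Π_v ⊴ Π^±_v` (`hN`) of finite index (`hI`),
`Π^±_v ∩ Π̂_v ⊆ Π_v` (`hinf`), `Π̂_v = cl Π_v` (`hhat`), bicontinuous agreement restricting to `φ`; datum side — [IUTchI] Prop 2.4 (i) (`h24i`);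
per `ℍ'`: `Π̂_{ℍ'}` = closure (`hH'`), `Cor23Hyp`, Cor 2.3 (iii)/(iv)/(v), admissible tower + coverings of semi-graphs with Cor 2.3 (vi) per level,
(D3) stabilisers, `Ĵ_i ⊆ cl ιX(φ(Π_v))`.  PROVED. ([IUTchII] Cor 2.4 (i), kurims pp.69–71) [claim: Mochizuki2012, status: disputed] -/
theorem cor24_i_ofSpecialFibre_graphTower_comap
    (hlev : ∀ (Q I : Subgroup W.Corhat), Cu.IsCuspidalInertia Q I ↔
      I ≤ Q ∧ ∃ I₀ : Subgroup W.Corhat, Cu.IsCuspidalInertia W.piPM I₀ ∧ I = I₀ ⊓ Q)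
    (hinf : W.piPM ⊓ W.hat ≤ W.piV) (hhat : (W.hat : Set W.Corhat) = closure (W.piV : Set W.Corhat))
    (A : StableCurveAgreement W Cu
      (StableCurveTemperedData.ofSpecialFibre X d Sf h36 Sigma SigmaHat hsub hne hprime hp TpH HatH hle cMH))
    (hA : IsHomeomorph A.eHat)
    (φ : T.Xplain ≃* (StableCurveTemperedData.ofSpecialFibre X d Sf h36 Sigma SigmaHat hsub hne hprime hp TpH HatH hle cMH).PiTp)
    (hφ : ∀ x : T.Xplain, A.eHat ⟨W.emb x, W.emb_le_pmHat ⟨x, rfl⟩⟩ =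
      (StableCurveTemperedData.ofSpecialFibre X d Sf h36 Sigma SigmaHat hsub hne hprime hp TpH HatH hle cMH).ιX (φ x))
    (hN : T.incl.range.Normal) (hI : T.incl.range.index ≠ 0)
    (h24i : (StableCurveTemperedData.ofSpecialFibre X d Sf h36 Sigma SigmaHat hsub hne hprime hp TpH HatH hle cMH).Prop24i)
    (I : Subgroup W.Corhat) (TpH' : Subgroup Sf.chart.G)
    (HatH' : Subgroup (TemperedGraphGroupData.exists_completion_of_prop36 Sf.Gc h36 Sf.chart).choose)
    (hle' : TpH'.map (TemperedGraphGroupData.exists_completion_of_prop36 Sf.Gc h36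
      Sf.chart).choose_spec.choose.toMonoidHom ≤ HatH')
    (cMH' : {x : X.Pt // X.IsCusp x} → Prop)
    (hH' : ((StableCurveTemperedData.ofSpecialFibre X d Sf h36 Sigma SigmaHat hsub hne hprime hp TpH' HatH' hle' cMH').graph.HatH :
        Set (StableCurveTemperedData.ofSpecialFibre X d Sf h36 Sigma SigmaHat hsub hne hprime hp TpH' HatH' hle' cMH').graph.Hat) =
      closure ((StableCurveTemperedData.ofSpecialFibre X d Sf h36 Sigma SigmaHat hsub hne hprime hp TpH' HatH' hle' cMH').graph.ι ''
        (StableCurveTemperedData.ofSpecialFibre X d Sf h36 Sigma SigmaHat hsub hne hprime hp TpH' HatH' hle' cMH').graph.TpH))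
    (hHyp' : (StableCurveTemperedData.ofSpecialFibre X d Sf h36 Sigma SigmaHat hsub hne hprime hp TpH' HatH' hle' cMH').Cor23Hyp)
    (h23iii' : (StableCurveTemperedData.ofSpecialFibre X d Sf h36 Sigma SigmaHat hsub hne hprime hp TpH' HatH' hle' cMH').Cor23iii)
    (h23iv' : (StableCurveTemperedData.ofSpecialFibre X d Sf h36 Sigma SigmaHat hsub hne hprime hp TpH' HatH' hle' cMH').Cor23iv)
    (h23v' : (StableCurveTemperedData.ofSpecialFibre X d Sf h36 Sigma SigmaHat hsub hne hprime hp TpH' HatH' hle' cMH').Cor23v)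
    (Tw : (StableCurveTemperedData.ofSpecialFibre X d Sf h36 Sigma SigmaHat hsub hne hprime hp TpH' HatH' hle' cMH').Prop24Tower)
    (V : Tw.I → Subgroup (StableCurveTemperedData.ofSpecialFibre X d Sf h36 Sigma SigmaHat hsub hne hprime hp TpH' HatH' hle' cMH').graph.Hat)
    (hJhat : ∀ i (y : (StableCurveTemperedData.ofSpecialFibre X d Sf h36 Sigma SigmaHat hsub hne hprime hp TpH' HatH' hle' cMH').DeltaHat),
      (y : (StableCurveTemperedData.ofSpecialFibre X d Sf h36 Sigma SigmaHat hsub hne hprime hp TpH' HatH' hle' cMH').PiHat) ∈ Tw.Jhat i ↔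
        (StableCurveTemperedData.ofSpecialFibre X d Sf h36 Sigma SigmaHat hsub hne hprime hp TpH' HatH' hle' cMH').ρHat y ∈ V i)
    (hVn : ∀ i, (V i).Normal)
    (hVo : ∀ i, IsOpen (V i : Set (StableCurveTemperedData.ofSpecialFibre X d Sf h36 Sigma SigmaHat hsub hne hprime hp TpH' HatH' hle' cMH').graph.Hat))
    (hV : ∀ O ∈ 𝓝 (1 : (StableCurveTemperedData.ofSpecialFibre X d Sf h36 Sigma SigmaHat hsub hne hprime hp TpH' HatH' hle' cMH').graph.Hat),
      ∃ i, (V i : Set _) ⊆ O)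
    (Cv : Tw.CoveringLevelGraphs) (Ad : ∀ i, Cv.toLevelData.LevelDatum i) (h23vi : ∀ i, (Ad i).lev.Cor23vi)
    (hst : ∀ i (γ : (StableCurveTemperedData.ofSpecialFibre X d Sf h36 Sigma SigmaHat hsub hne hprime hp TpH' HatH' hle' cMH').DeltaTp),
      (∀ v ∈ Cv.toLevelData.compH i, Cv.toLevelData.act i
        (γ : (StableCurveTemperedData.ofSpecialFibre X d Sf h36 Sigma SigmaHat hsub hne hprime hp TpH' HatH' hle' cMH').PiTp) v ∈
          Cv.toLevelData.compH i) →
        ∃ ĥ ∈ (StableCurveTemperedData.ofSpecialFibre X d Sf h36 Sigma SigmaHat hsub hne hprime hp TpH' HatH' hle' cMH').graph.HatH,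
          ĥ⁻¹ * (StableCurveTemperedData.ofSpecialFibre X d Sf h36 Sigma SigmaHat hsub hne hprime hp TpH' HatH' hle' cMH').graph.ι
            ((StableCurveTemperedData.ofSpecialFibre X d Sf h36 Sigma SigmaHat hsub hne hprime hp TpH' HatH' hle' cMH').ρTp γ) ∈ V i)
    (hJ : ∀ i, (Tw.Jhat i : Set (StableCurveTemperedData.ofSpecialFibre X d Sf h36 Sigma SigmaHat hsub hne hprime hp TpH' HatH' hle' cMH').PiHat) ⊆
      closure (((T.incl.range.map φ.toMonoidHom).map
        (StableCurveTemperedData.ofSpecialFibre X d Sf h36 Sigma SigmaHat hsub hne hprime hp TpH HatH hle cMH).ιX : Subgroup _) : Set _)) :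
    Literature.IUT.HodgeArakelov.Cor24_i W Cu
      (((StableCurveTemperedData.ofSpecialFibre X d Sf h36 Sigma SigmaHat hsub hne hprime hp TpH' HatH' hle'
        cMH').piTpXH.comap φ.toMonoidHom).comap T.incl) I :=
  A.cor24_i_ofSpecialFibre_graphTower (by rw [W.index_piV_subgroupOf_piPM]; exact hI) hlev hinf hA h24i I TpH' HatH' hle' cMH' hH'
    (A.deltaPmBox_comap_eq_ofSpecialFibre hA φ hφ hN hI TpH' HatH' hle' cMH' hHyp' h23iii' h23iv') h23v' Tw V hJhat hVn hVo hV Cv Ad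
    h23vi hst (A.hlevV_of_le_closure hA hhat φ hφ Tw.Jhat hJ)

end SpecialFibre

end StableCurveAgreement

end PlusMinusTower

end Literature.IUT.HodgeArakelov

end
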